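import Summits.CriticalPhenomena.Ising3D.TaylorTableEvenHeadDeltaRows
import Summits.CriticalPhenomena.Ising3D.TaylorTableEvenHeadParts
import Summits.CriticalPhenomena.Ising3D.TaylorTableEvenRowsTable
import Mathlib.Tactic.Linarith
import Mathlib.Tactic.Positivity
import Mathlib.Tactic.Ring
import HarnessLib

/-!
# The TABLE layer of a derivative certificate, XX: even head cells over a WIDE box — δ-expanded row triples × Taylor models, split into parts
(cell `pub-ising3x`, seat boot-1 gen 8; gate (g2) — the head layer's "late boxing", cells half)

HONEST FRAMING: lottery ticket; floor = tightest certified 3D Ising CFT bounds; no exact-solution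
claim without a proof. Island framing: certified exclusion region at stated derivative order and
assumptions; not a determination of the 3D Ising critical exponents beyond that.

The head polynomial of a cell in the local variable `ρ = Δ − ctr` is carried as a TRIPLE `(H₀, H₁, H₂)(ρ)`: the rows of
each δ-order (`HeadRowsΔ`, TaylorTableEvenHeadDeltaRows) Taylor-shifted to `n + ctr` exactly and multiplied by the
Literature Taylor models `HRTM.rows` — the landed `headPolyTM` applied order by order (it is linear in the rows,
`evalR_headPolyTMR_val3`) — split into claimed PARTS exactly as `TaylorTableEvenHeadParts` (claims are triples,
`HeadPart3`; per part ONE declaration `evenHeadPartOKΔ` = 9 containments with the models built once; the landed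
`parts_pmem` is applied to each order view `HeadPart3.ord0/1/2`), and the final sign tests (`evenHeadPartsFinalOKΔ`) are
recog-1's triple checkers on the SUMMED claims over `[−2^{−e}, 2^{−e}]`: `posOn3` for `X̃` (`|δσ| ≤ Wσ`) and `Ỹ`
(`|δε| ≤ Wε`), the product-free `posOnDE3` for `4X̃Ỹ − Z̃²` (three independent δ's). No δ–ρ correlation is collapsed
before the sign test. **`evenHead_nonneg_of_partsΔ`**: `ValidΔ` + all part checks + the final check ⇒ the head form is
PSD on box × cell — literally the conclusion of `evenHead_nonneg_of_parts` (the per-cell statement of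
`TaylorTable.EvenHeads`). SUFFICIENT only (interval slack). Sources: Kos–Poland–Simmons-Duffin 2014 §3.3 eq. (3.16)
(the obligation); Moore 1966 Ch. 3; Makino–Berz Taylor models (the Literature `HRTM`). Elementary given the tree. [folklore]
-/

namespace Summit.CriticalPhenomena.Ising3D

open Finset Set
open Literature.Analysis.ValidatedNumerics Literature.Analysis.ValidatedNumerics.PolyMP
open Literature.Analysis.ValidatedNumerics.NumericsMP (MI)
open Literature.MathematicalPhysics.QuantumFieldTheory.ConformalBootstrap3D

/-! ### Parts with triple claims -/

/-- One claimed part of a head cell, δ-expanded: term range `[t0, t0 + count)` and the claimed TRIPLES of the three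
partial head polynomials. [folklore] -/
structure HeadPart3 where
  /-- first term index -/
  t0 : ℕ
  /-- number of terms -/
  count : ℕ
  /-- claimed partial `X̃` triple -/
  PX : ITriple
  /-- claimed partial `Ỹ` triple -/
  PY : ITriple
  /-- claimed partial `Z̃` triple -/
  PZ : ITriple

namespace HeadPart3

/-- The order-0 part (landed `HeadPart` shape). [folklore] -/
def ord0 (p : HeadPart3) : HeadPart := ⟨p.t0, p.count, p.PX.1, p.PY.1, p.PZ.1⟩
/-- The order-1 part. [folklore] -/
def ord1 (p : HeadPart3) : HeadPart := ⟨p.t0, p.count, p.PX.2.1, p.PY.2.1, p.PZ.2.1⟩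
/-- The order-2 part. [folklore] -/
def ord2 (p : HeadPart3) : HeadPart := ⟨p.t0, p.count, p.PX.2.2, p.PY.2.2, p.PZ.2.2⟩

end HeadPart3

/-- The tilings of the three order views agree (same ranges). [folklore] -/
theorem tilesOK_ord1 : ∀ (ps : List HeadPart3) (pos n : ℕ),
    tilesOK pos (ps.map HeadPart3.ord1) n = tilesOK pos (ps.map HeadPart3.ord0) n
  | [], _, _ => rfl
  | p :: ps, pos, n => by
      simp only [List.map_cons, tilesOK, HeadPart3.ord1, HeadPart3.ord0, tilesOK_ord1 ps]

/-- See `tilesOK_ord1`. [folklore] -/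
theorem tilesOK_ord2 : ∀ (ps : List HeadPart3) (pos n : ℕ),
    tilesOK pos (ps.map HeadPart3.ord2) n = tilesOK pos (ps.map HeadPart3.ord0) n
  | [], _, _ => rfl
  | p :: ps, pos, n => by
      simp only [List.map_cons, tilesOK, HeadPart3.ord2, HeadPart3.ord0, tilesOK_ord2 ps]

/-- Per-order part check with a GIVEN Taylor-model table (so that one declaration builds the models once). [folklore] -/
def headPartOKWith (tms : List (List IPoly)) (Rm : EvenRows) (C : EvenCellTM) (pm : HeadPart) : Bool :=
  subsetI (headPolyTM Rm.S Rm.RX tms C.nF C.ℓ C.ctr (pm.slice C.F)) pm.PX &&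
    subsetI (headPolyTM Rm.S Rm.RY tms C.nF C.ℓ C.ctr (pm.slice C.F)) pm.PY &&
    subsetI (headPolyTM Rm.S Rm.RZ tms C.nF C.ℓ C.ctr (pm.slice C.F)) pm.PZ

/-- **Per-part check, δ-expanded** (one kernel declaration each): the computed partial head TRIPLES on the slice are
contained in the claims (9 containments; the Taylor models are built once). [folklore] -/
def evenHeadPartOKΔ (R : HeadRowsΔ) (C : EvenCellTM) (p : HeadPart3) : Bool :=
  let tms := HRTM.rows R.S C.ctr C.ℓ C.e C.D C.nF
  headPartOKWith tms R.rows0 C p.ord0 && headPartOKWith tms R.rows1 C p.ord1 && headPartOKWith tms R.rows2 C p.ord2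

/-- Summed `X̃` claims as a triple. [folklore] -/
def sum3X (ps : List HeadPart3) : ITriple :=
  (sumPX (ps.map HeadPart3.ord0), sumPX (ps.map HeadPart3.ord1), sumPX (ps.map HeadPart3.ord2))
/-- Summed `Ỹ` claims as a triple. [folklore] -/
def sum3Y (ps : List HeadPart3) : ITriple :=
  (sumPY (ps.map HeadPart3.ord0), sumPY (ps.map HeadPart3.ord1), sumPY (ps.map HeadPart3.ord2))
/-- Summed `Z̃` claims as a triple. [folklore] -/
def sum3Z (ps : List HeadPart3) : ITriple :=
  (sumPZ (ps.map HeadPart3.ord0), sumPZ (ps.map HeadPart3.ord1), sumPZ (ps.map HeadPart3.ord2))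

/-- **Final check, δ-expanded** (one declaration): side conditions, the tiling, and recog-1's triple sign tests on the
SUMMED claims over the local cell `[−2^{−e}, 2^{−e}]`: `posOn3` for `X̃` (`|δσ| ≤ Wσ`) and `Ỹ` (`|δε| ≤ Wε`), the
product-free `posOnDE3` for `4X̃Ỹ − Z̃²` (bisection depth `dP`). [folklore] -/
def evenHeadPartsFinalOKΔ (R : HeadRowsΔ) (dP : ℕ) (C : EvenCellTM) (ps : List HeadPart3) : Bool :=
  decide (1 ≤ C.D) && HRTM.pivOK C.ctr C.ℓ C.e C.nF && (C.F.all fun q => decide (q.2 < R.J)) &&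
    tilesOK 0 (ps.map HeadPart3.ord0) C.F.length &&
    posOn3 R.S (sum3X ps).1 (sum3X ps).2.1 (sum3X ps).2.2 R.Wσ dP (-C.hw) C.hw &&
    posOn3 R.S (sum3Y ps).1 (sum3Y ps).2.1 (sum3Y ps).2.2 R.Wε dP (-C.hw) C.hw &&
    posOnDE3 R.S (sum3X ps) (sum3Y ps) (sum3Z ps) R.Wσ R.Wε R.Wb dP (-C.hw) C.hw

/-! ### Soundness -/

/-- The head polynomial is linear in the rows: on a combined row `r₀ + δ r₁ + δ² r₂` its value is the `val3` of the
three order-wise head polynomials. [folklore] -/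
theorem evalR_headPolyTMR_val3 (row0 row1 row2 : ℕ → List ℝ) (asq : ℕ × ℕ → List ℝ) (ℓ : ℕ) (ctr : ℚ)
    (ρ δ : ℝ) : ∀ F : List (ℕ × ℕ),
    evalR (headPolyTMR (fun j => addR (row0 j) (addR (smulR δ (row1 j)) (smulR (δ ^ 2) (row2 j)))) asq ℓ ctr F) ρ =
      evalR (headPolyTMR row0 asq ℓ ctr F) ρ + δ * evalR (headPolyTMR row1 asq ℓ ctr F) ρ +
        δ ^ 2 * evalR (headPolyTMR row2 asq ℓ ctr F) ρ
  | [] => by simp [headPolyTMR]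
  | q :: qs => by
      simp only [headPolyTMR, evalR_addR, evalR_smulR, evalR_mulR, evalR_shiftR,
        evalR_headPolyTMR_val3 row0 row1 row2 asq ℓ ctr ρ δ qs]
      ring

/-- **TABLE THEOREM, even head cell over a WIDE box (δ-expanded row triples × Taylor models, split into parts).**
For rational weights `c` on the duplicate-free index list, a cell `C` (head list duplicate-free, in the descendant
range, `ℓ ≤ lo`), δ-rows `R` VALID on the box, every part's containment check and the final triple sign tests on the
summed claims: the head form is PSD at every `(Δσ, Δε)` of the box and every `Δ` of the cell — literally the conclusion
of `evenHead_nonneg_of_parts` (the per-cell statement of `TaylorTable.EvenHeads`).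
[cite: KosPolandSimmonsduffin2014, §3.3 eq. (3.16)] -/
theorem evenHead_nonneg_of_partsΔ (c : Fin 5 → ℕ × ℕ → ℚ) {L : List (ℕ × ℕ)} {C : EvenCellTM} (hF : C.F.Nodup)
    (hFj : ∀ q ∈ C.F, q.2 ≤ C.ℓ + q.1) (hℓlo : (C.ℓ : ℚ) ≤ C.lo) {σlo σhi εlo εhi : ℚ} {R : HeadRowsΔ}
    (hR : R.ValidΔ c L σlo σhi εlo εhi) {dP : ℕ} {ps : List HeadPart3}
    (hparts : ∀ p ∈ ps, evenHeadPartOKΔ R C p = true) (h : evenHeadPartsFinalOKΔ R dP C ps = true) :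
    ∀ p ∈ Icc (σlo : ℝ) σhi ×ˢ Icc (εlo : ℝ) εhi, ∀ Δ : ℝ, (C.lo : ℝ) ≤ Δ → Δ ≤ C.hi → ∀ a b : ℝ,
      0 ≤ ∑ q ∈ C.F.toFinset, hrCoeff Δ C.ℓ q.1 q.2 / legendreLam C.ℓ *
        (taylorCrossing (1 / 2) (1 / 2) L.toFinset (fun i ab => (c i ab : ℝ))).evenForm p.1 p.2
          (zMono (Δ + (q.1 : ℝ)) q.2) a b := by
  intro p hp Δ hlo hhi a b
  obtain ⟨hS, hWσ, hWε, hV⟩ := hR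
  obtain ⟨hδσ, hδε, hrows⟩ := hV p hp
  have hWb : 0 ≤ R.Wb := by unfold HeadRowsΔ.Wb; linarith
  have hδb : |(p.1 + p.2) / 2 - R.b0| ≤ R.Wb := by
    unfold HeadRowsΔ.b0 HeadRowsΔ.Wb
    rw [abs_le] at hδσ hδε ⊢
    push_cast
    constructor <;> linarith [hδσ.1, hδσ.2, hδε.1, hδε.2]
  simp only [evenHeadPartsFinalOKΔ, Bool.and_eq_true, decide_eq_true_eq, List.all_eq_true] at h
  obtain ⟨⟨⟨⟨⟨⟨hD, hpiv⟩, hJ⟩, htile⟩, hX⟩, hY⟩, hDisc⟩ := h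
  -- the local variable
  set ρ : ℝ := Δ - (C.ctr : ℝ) with hρdef
  have hΔ : Δ = (C.ctr : ℝ) + ρ := by rw [hρdef]; ring
  have hlo' : ((C.lo : ℚ) : ℝ) = (C.ctr : ℝ) - ((C.hw : ℚ) : ℝ) := by rw [EvenCellTM.lo]; push_cast; ring
  have hhi' : ((C.hi : ℚ) : ℝ) = (C.ctr : ℝ) + ((C.hw : ℚ) : ℝ) := by rw [EvenCellTM.hi]; push_cast; ring
  have hρ1 : ((-C.hw : ℚ) : ℝ) ≤ ρ := by push_cast; linarith
  have hρ2 : ρ ≤ ((C.hw : ℚ) : ℝ) := by linarith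
  have hρabs : |ρ| ≤ ((1 : ℚ) / 2 ^ C.e : ℚ) := by
    have : ((C.hw : ℚ) : ℝ) = (((1 : ℚ) / 2 ^ C.e : ℚ) : ℝ) := by rw [EvenCellTM.hw]
    rw [abs_le, ← this]; exact ⟨by linarith, hρ2⟩
  have hℓΔ : (C.ℓ : ℝ) ≤ Δ := by
    have : ((C.ℓ : ℚ) : ℝ) ≤ ((C.lo : ℚ) : ℝ) := by exact_mod_cast hℓlo
    push_cast at this
    linarith
  -- Taylor models of the coefficients at this ρ
  have htm : ∀ q ∈ C.F, ∃ as : List ℝ, PMem R.S as (HRTM.rowEntry (HRTM.rows R.S C.ctr C.ℓ C.e C.D C.nF) C.nF q.1 q.2) ∧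
      hrCoeff ((C.ctr : ℝ) + ρ) C.ℓ q.1 q.2 = evalR as ρ :=
    fun q hq => HRTM.tmem_rows hD hpiv (C.le_nF q hq) q.2 ρ hρabs
  classical
  let asq : ℕ × ℕ → List ℝ := fun q => if hq : q ∈ C.F then Classical.choose (htm q hq) else []
  have hasq_mem : ∀ q ∈ C.F, PMem R.S (asq q) (HRTM.rowEntry (HRTM.rows R.S C.ctr C.ℓ C.e C.D C.nF) C.nF q.1 q.2) := by
    intro q hq; simp only [asq, dif_pos hq]; exact (Classical.choose_spec (htm q hq)).1
  have hasq_val : ∀ q ∈ C.F, hrCoeff ((C.ctr : ℝ) + ρ) C.ℓ q.1 q.2 = evalR (asq q) ρ := by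
    intro q hq; simp only [asq, dif_pos hq]; exact (Classical.choose_spec (htm q hq)).2
  -- row triples from the contract (choose per j)
  let rX : ℕ → List ℝ × List ℝ × List ℝ := fun j =>
    if hj : j < R.J then Classical.choose (hrows j hj).1 else ([], [], [])
  let rY : ℕ → List ℝ × List ℝ × List ℝ := fun j =>
    if hj : j < R.J then Classical.choose (hrows j hj).2.1 else ([], [], [])
  let rZ : ℕ → List ℝ × List ℝ × List ℝ := fun j =>
    if hj : j < R.J then Classical.choose (hrows j hj).2.2 else ([], [], [])
  have sX : ∀ q ∈ C.F, (PMem R.S (rX q.2).1 (R.RX0.getD q.2 []) ∧ PMem R.S (rX q.2).2.1 (R.RX1.getD q.2 []) ∧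
      PMem R.S (rX q.2).2.2 (R.RX2.getD q.2 [])) ∧
      ∀ E : ℝ, qSum (fun ab => (c 0 ab : ℝ)) L.toFinset p.1 (-1) E q.2 = val3 (rX q.2) E (p.1 - R.σ0) := by
    intro q hq
    have hs := Classical.choose_spec (hrows q.2 (hJ q hq)).1
    simp only [rX, dif_pos (hJ q hq)]
    rw [HeadRowsΔ.RX0, HeadRowsΔ.RX1, HeadRowsΔ.RX2, R.getD_proj _ rfl, R.getD_proj _ rfl, R.getD_proj _ rfl]
    exact ⟨⟨hs.1.fst, hs.1.snd, hs.1.thd⟩, hs.2⟩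
  have sY : ∀ q ∈ C.F, (PMem R.S (rY q.2).1 (R.RY0.getD q.2 []) ∧ PMem R.S (rY q.2).2.1 (R.RY1.getD q.2 []) ∧
      PMem R.S (rY q.2).2.2 (R.RY2.getD q.2 [])) ∧
      ∀ E : ℝ, qSum (fun ab => (c 1 ab : ℝ)) L.toFinset p.2 (-1) E q.2 = val3 (rY q.2) E (p.2 - R.ε0) := by
    intro q hq
    have hs := Classical.choose_spec (hrows q.2 (hJ q hq)).2.1
    simp only [rY, dif_pos (hJ q hq)]
    rw [HeadRowsΔ.RY0, HeadRowsΔ.RY1, HeadRowsΔ.RY2, R.getD_proj _ rfl, R.getD_proj _ rfl, R.getD_proj _ rfl]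
    exact ⟨⟨hs.1.fst, hs.1.snd, hs.1.thd⟩, hs.2⟩
  have sZ : ∀ q ∈ C.F, (PMem R.S (rZ q.2).1 (R.RZ0.getD q.2 []) ∧ PMem R.S (rZ q.2).2.1 (R.RZ1.getD q.2 []) ∧
      PMem R.S (rZ q.2).2.2 (R.RZ2.getD q.2 [])) ∧
      ∀ E : ℝ, qSum (fun ab => (c 3 ab : ℝ)) L.toFinset ((p.1 + p.2) / 2) (-1) E q.2 +
        qSum (fun ab => (c 4 ab : ℝ)) L.toFinset ((p.1 + p.2) / 2) 1 E q.2 = val3 (rZ q.2) E ((p.1 + p.2) / 2 - R.b0) := by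
    intro q hq
    have hs := Classical.choose_spec (hrows q.2 (hJ q hq)).2.2
    simp only [rZ, dif_pos (hJ q hq)]
    rw [HeadRowsΔ.RZ0, HeadRowsΔ.RZ1, HeadRowsΔ.RZ2, R.getD_proj _ rfl, R.getD_proj _ rfl, R.getD_proj _ rfl]
    exact ⟨⟨hs.1.fst, hs.1.snd, hs.1.thd⟩, hs.2⟩
  -- the parts, order by order (the landed `parts_pmem` on each order view)
  have hpart : ∀ p' ∈ ps, headPartOKWith (HRTM.rows R.S C.ctr C.ℓ C.e C.D C.nF) R.rows0 C p'.ord0 = true ∧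
      headPartOKWith (HRTM.rows R.S C.ctr C.ℓ C.e C.D C.nF) R.rows1 C p'.ord1 = true ∧
      headPartOKWith (HRTM.rows R.S C.ctr C.ℓ C.e C.D C.nF) R.rows2 C p'.ord2 = true := by
    intro p' hp'
    have h := hparts p' hp'
    simp only [evenHeadPartOKΔ, Bool.and_eq_true] at h
    exact ⟨h.1.1, h.1.2, h.2⟩
  have hp0 : ∀ p' ∈ ps.map HeadPart3.ord0,
      (subsetI (headPolyTM R.S R.RX0 (HRTM.rows R.S C.ctr C.ℓ C.e C.D C.nF) C.nF C.ℓ C.ctr (p'.slice C.F)) p'.PX &&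
      subsetI (headPolyTM R.S R.RY0 (HRTM.rows R.S C.ctr C.ℓ C.e C.D C.nF) C.nF C.ℓ C.ctr (p'.slice C.F)) p'.PY &&
      subsetI (headPolyTM R.S R.RZ0 (HRTM.rows R.S C.ctr C.ℓ C.e C.D C.nF) C.nF C.ℓ C.ctr (p'.slice C.F)) p'.PZ) = true := by
    intro p' hp'
    obtain ⟨p3, hp3, rfl⟩ := List.mem_map.mp hp'
    exact (hpart p3 hp3).1
  have hp1 : ∀ p' ∈ ps.map HeadPart3.ord1,
      (subsetI (headPolyTM R.S R.RX1 (HRTM.rows R.S C.ctr C.ℓ C.e C.D C.nF) C.nF C.ℓ C.ctr (p'.slice C.F)) p'.PX &&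
      subsetI (headPolyTM R.S R.RY1 (HRTM.rows R.S C.ctr C.ℓ C.e C.D C.nF) C.nF C.ℓ C.ctr (p'.slice C.F)) p'.PY &&
      subsetI (headPolyTM R.S R.RZ1 (HRTM.rows R.S C.ctr C.ℓ C.e C.D C.nF) C.nF C.ℓ C.ctr (p'.slice C.F)) p'.PZ) = true := by
    intro p' hp'
    obtain ⟨p3, hp3, rfl⟩ := List.mem_map.mp hp'
    exact (hpart p3 hp3).2.1
  have hp2 : ∀ p' ∈ ps.map HeadPart3.ord2,
      (subsetI (headPolyTM R.S R.RX2 (HRTM.rows R.S C.ctr C.ℓ C.e C.D C.nF) C.nF C.ℓ C.ctr (p'.slice C.F)) p'.PX &&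
      subsetI (headPolyTM R.S R.RY2 (HRTM.rows R.S C.ctr C.ℓ C.e C.D C.nF) C.nF C.ℓ C.ctr (p'.slice C.F)) p'.PY &&
      subsetI (headPolyTM R.S R.RZ2 (HRTM.rows R.S C.ctr C.ℓ C.e C.D C.nF) C.nF C.ℓ C.ctr (p'.slice C.F)) p'.PZ) = true := by
    intro p' hp'
    obtain ⟨p3, hp3, rfl⟩ := List.mem_map.mp hp'
    exact (hpart p3 hp3).2.2
  have htile1 : tilesOK 0 (ps.map HeadPart3.ord1) C.F.length = true := by rw [tilesOK_ord1]; exact htile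
  have htile2 : tilesOK 0 (ps.map HeadPart3.ord2) C.F.length = true := by rw [tilesOK_ord2]; exact htile
  obtain ⟨ax0, ay0, az0, mX0, mY0, mZ0, eX0, eY0, eZ0⟩ :=
    parts_pmem hS (ℓ := C.ℓ) (ctr := C.ctr) (RX := R.RX0) (RY := R.RY0) (RZ := R.RZ0)
      (rowX := fun j => (rX j).1) (rowY := fun j => (rY j).1) (rowZ := fun j => (rZ j).1)
      (fun q hq => (sX q hq).1.1) (fun q hq => (sY q hq).1.1) (fun q hq => (sZ q hq).1.1) hasq_mem ρ
      (ps.map HeadPart3.ord0) 0 htile hp0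
  obtain ⟨ax1, ay1, az1, mX1, mY1, mZ1, eX1, eY1, eZ1⟩ :=
    parts_pmem hS (ℓ := C.ℓ) (ctr := C.ctr) (RX := R.RX1) (RY := R.RY1) (RZ := R.RZ1)
      (rowX := fun j => (rX j).2.1) (rowY := fun j => (rY j).2.1) (rowZ := fun j => (rZ j).2.1)
      (fun q hq => (sX q hq).1.2.1) (fun q hq => (sY q hq).1.2.1) (fun q hq => (sZ q hq).1.2.1) hasq_mem ρ
      (ps.map HeadPart3.ord1) 0 htile1 hp1
  obtain ⟨ax2, ay2, az2, mX2, mY2, mZ2, eX2, eY2, eZ2⟩ :=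
    parts_pmem hS (ℓ := C.ℓ) (ctr := C.ctr) (RX := R.RX2) (RY := R.RY2) (RZ := R.RZ2)
      (rowX := fun j => (rX j).2.2) (rowY := fun j => (rY j).2.2) (rowZ := fun j => (rZ j).2.2)
      (fun q hq => (sX q hq).1.2.2) (fun q hq => (sY q hq).1.2.2) (fun q hq => (sZ q hq).1.2.2) hasq_mem ρ
      (ps.map HeadPart3.ord2) 0 htile2 hp2
  rw [List.drop_zero] at eX0 eY0 eZ0 eX1 eY1 eZ1 eX2 eY2 eZ2
  have pX : PMem3 R.S (ax0, ax1, ax2) (sum3X ps) := ⟨mX0, mX1, mX2⟩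
  have pY : PMem3 R.S (ay0, ay1, ay2) (sum3Y ps) := ⟨mY0, mY1, mY2⟩
  have pZ : PMem3 R.S (az0, az1, az2) (sum3Z ps) := ⟨mZ0, mZ1, mZ2⟩
  -- the three real values as `val3` of the chosen coefficient lists
  have eX : evenHeadX (fun ab => (c 0 ab : ℝ)) L.toFinset C.ℓ C.F p.1 ((C.ctr : ℝ) + ρ) (-1) =
      val3 (ax0, ax1, ax2) ρ (p.1 - R.σ0) := by
    have key := evenHeadX_eq_evalR_rows (w := fun ab => (c 0 ab : ℝ)) (Sx := L.toFinset) (s := p.1) (σ := (-1 : ℝ))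
      C.ℓ C.ctr C.F ρ
      (row := fun j => addR (rX j).1 (addR (smulR (p.1 - R.σ0) (rX j).2.1) (smulR ((p.1 - R.σ0) ^ 2) (rX j).2.2)))
      (by intro q hq E; rw [(sX q hq).2 E, val3, evalR_addR, evalR_addR, evalR_smulR, evalR_smulR, add_assoc]) hasq_val
    rw [key, evalR_headPolyTMR_val3, ← eX0, ← eX1, ← eX2]; simp only [val3]
  have eY : evenHeadX (fun ab => (c 1 ab : ℝ)) L.toFinset C.ℓ C.F p.2 ((C.ctr : ℝ) + ρ) (-1) =
      val3 (ay0, ay1, ay2) ρ (p.2 - R.ε0) := by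
    have key := evenHeadX_eq_evalR_rows (w := fun ab => (c 1 ab : ℝ)) (Sx := L.toFinset) (s := p.2) (σ := (-1 : ℝ))
      C.ℓ C.ctr C.F ρ
      (row := fun j => addR (rY j).1 (addR (smulR (p.2 - R.ε0) (rY j).2.1) (smulR ((p.2 - R.ε0) ^ 2) (rY j).2.2)))
      (by intro q hq E; rw [(sY q hq).2 E, val3, evalR_addR, evalR_addR, evalR_smulR, evalR_smulR, add_assoc]) hasq_val
    rw [key, evalR_headPolyTMR_val3, ← eY0, ← eY1, ← eY2]; simp only [val3]
  have eZ : evenHeadX (fun ab => (c 3 ab : ℝ)) L.toFinset C.ℓ C.F ((p.1 + p.2) / 2) ((C.ctr : ℝ) + ρ) (-1) +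
      evenHeadX (fun ab => (c 4 ab : ℝ)) L.toFinset C.ℓ C.F ((p.1 + p.2) / 2) ((C.ctr : ℝ) + ρ) 1 =
      val3 (az0, az1, az2) ρ ((p.1 + p.2) / 2 - R.b0) := by
    set δ : ℝ := (p.1 + p.2) / 2 - R.b0 with hδdef
    have hsum : evenHeadX (fun ab => (c 3 ab : ℝ)) L.toFinset C.ℓ C.F ((p.1 + p.2) / 2) ((C.ctr : ℝ) + ρ) (-1) +
        evenHeadX (fun ab => (c 4 ab : ℝ)) L.toFinset C.ℓ C.F ((p.1 + p.2) / 2) ((C.ctr : ℝ) + ρ) 1 =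
        evalR (headPolyTMR (fun j => addR (rZ j).1 (addR (smulR δ (rZ j).2.1) (smulR (δ ^ 2) (rZ j).2.2)))
          asq C.ℓ C.ctr C.F) ρ := by
      rw [evalR_headPolyTMR, evenHeadX, evenHeadX, ← List.sum_map_add]
      congr 1
      refine List.map_congr_left fun q hq => ?_
      have ez := (sZ q hq).2 ((C.ctr : ℝ) + ρ + (q.1 : ℝ))
      rw [val3] at ez
      have ez' : evalR (rZ q.2).1 ((C.ctr : ℝ) + ρ + (q.1 : ℝ)) +
          (δ * evalR (rZ q.2).2.1 ((C.ctr : ℝ) + ρ + (q.1 : ℝ)) +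
            δ ^ 2 * evalR (rZ q.2).2.2 ((C.ctr : ℝ) + ρ + (q.1 : ℝ))) =
          qSum (fun ab => (c 3 ab : ℝ)) L.toFinset ((p.1 + p.2) / 2) (-1) ((C.ctr : ℝ) + ρ + (q.1 : ℝ)) q.2 +
            qSum (fun ab => (c 4 ab : ℝ)) L.toFinset ((p.1 + p.2) / 2) 1 ((C.ctr : ℝ) + ρ + (q.1 : ℝ)) q.2 := by
        rw [ez]; ring
      rw [← hasq_val q hq, show (q.1 : ℝ) + (C.ctr : ℝ) + ρ = (C.ctr : ℝ) + ρ + (q.1 : ℝ) by ring,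
        evalR_addR, evalR_addR, evalR_smulR, evalR_smulR, ez']
      have hlam : ((PointKernel.legendreLamQ C.ℓ : ℚ) : ℝ) = legendreLam C.ℓ := PointKernel.cast_legendreLamQ C.ℓ
      push_cast
      rw [hlam]
      have hl0 : legendreLam C.ℓ ≠ 0 := (legendreLam_pos C.ℓ).ne'
      have h2 : (2 : ℝ) ^ q.1 ≠ 0 := pow_ne_zero _ two_ne_zero
      rw [one_div_pow]
      field_simp
    rw [hsum, evalR_headPolyTMR_val3, ← eZ0, ← eZ1, ← eZ2]; simp only [val3]
  -- the sign tests
  have h1 := posOn3_sound hS hWσ mX0 mX1 mX2 hX hρ1 hρ2 hδσ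
  have h2 := posOn3_sound hS hWε mY0 mY1 mY2 hY hρ1 hρ2 hδε
  obtain ⟨-, -, h3⟩ := posOnDE3_sound hS hWσ hWε hWb pX pY pZ hDisc hρ1 hρ2 hδσ hδε hδb
  simp only [val3] at eX eY eZ h3
  rw [← eX] at h1 h3
  rw [← eY] at h2 h3
  rw [← eZ] at h3
  rw [hΔ]
  refine evenHead_nonneg_of_reduced L.toFinset (fun i ab => (c i ab : ℝ)) C.ℓ C.F hF hFj (hΔ ▸ hℓΔ) p.1 p.2
    h1.le h2.le ?_ a b
  nlinarith [h3]

end Summit.CriticalPhenomena.Ising3D
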